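import Summits.HubbardSuperconductivity.HubbardLadder.Bounds.PairCorrelationEtaLineEuclid
import Literature.MathematicalPhysics.QuantumLattice.HubbardSignGaugeBoundSharp
import Mathlib.Order.LiminfLimsup
import HarnessLib
import HarnessLib.Audit

/-!
# Hubbard ladder — Bounds: the sharp Koma–Tasaki MAGNETIC `η`-line `η_spin(T) ≥ T/(π|t|)`,
# machine-checked (bounds.tex Thm 10‴; magnetic twin of `PairCorrelationEtaLineEuclid.lean`)

HONEST FRAMING (cell pub-hubbard): ladder R1–R4 with certified numbers; no claim on H/H₀. These
are bounds for a MODEL CLASS — the grand-canonical Hubbard model `hubbardTorusWith 2 L t U μ` on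
the square torus `(ℤ/Lℤ)²` (every `L ≥ 1`, all real `t, U, μ`, every `β > 0`); no materials
claim. Companion text: `pub-hubbard/paper/bounds.tex` §Theorem 10 (Thm 10‴); tables
`pub-hubbard/pub-hubbard-bounds/BOUNDS.md` (row T8⁵, C2) and `EXTREMISERS.md` §5h.

## Content

Koma–Tasaki (PRL 68 (1992) 3248) bound the transverse spin correlation `⟨S⁺_x S⁻_y⟩` of the
Hubbard model "in the same way" as the pair correlation, with the spin-dependent sign gauge
`θ_{u↑} = +iφ_u`, `θ_{u↓} = -iφ_u`. The tree's `koma_tasaki_magnetic` (Literature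
`HubbardHubbardModel`, proved in `HubbardHubbardModelKomaTasakiProofs`) records the decay
`|⟨S⁺_x S⁻_y⟩| ≤ dist^{-f(β)}` with the weak explicit exponent `f(β) = 1/(128β|t| + 1)` (the
`ℓ^∞` test-function dipole and the hopping-norm constant `2`). This file proves the SHARP line:
the new Literature lemma `norm_thermalCorr_siteSpinPlus_le_sharp` (`HubbardSignGaugeBoundSharp`:
Koma–Tasaki's eq. (11) AS PRINTED also for sign gauges — `cosh` is even, so the Hermitian part
of the transformed hopping term is spin-independent; cost `β|t| Σ_u Σ_v [u∼v](cosh - 1)`, gauge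
charge `2`) combined with the explicit EUCLIDEAN truncated logarithmic dipole
`exists_euclidLogDipole` (Literature `TorusEuclidLogDipole`; gain `2q log ρ`, energy
`≤ 2(2πq²H(ρ) + 76q² + 544q⁴e^{2q²})`, `H(ρ) ≤ 1 + log ρ`) gives, for every `q ≥ 0` with
`f := 4q - 4πβ|t|q² ≥ 0`, uniformly in `L`:
`|⟨S⁺_x S⁻_y⟩_{β,L}| ≤ K(q) 5^f (dist(x,y)+1)^{-f}`, `K(q) = exp[2β|t|(2πq² + 76q² + 544q⁴e^{2q²})]`
— the SAME bound as for the pair correlation (`norm_pairCorr_le_rpow_euclid`), optimum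
`q* = 1/(2πβ|t|)`, `f* = 1/(πβ|t|) = T/(π|t|)`. Proved here:

* `le_rpow_euclid_of_apriori` — the generic step "a priori gauge bound with charge `c` and cost
  constant `b` ⟹ power law `K 5^f (dist+1)^{-f}`, `f = 2cq - 4πbq²`" (reused by
  `OneParticleDecayEuclid.lean` with `c = 1`);
* `exists_limsup_le_rpow` — the generic thermodynamic-limit step (torus distance from `0` to
  `z` equals `max|z_i| ≥ |z|/√2` once `L + 1 > 2 max|z_i|`; the constant is absorbed into an
  `ε`-slack of the exponent);
* `norm_spinCorr_le_rpow_euclid` — the explicit torus bound above;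
* `SpinEtaLineEuclid` / `spinEtaLineEuclid_holds` — torus-uniform form: `β|t| < 4/π`
  (`T > (π/4)|t|`) ⟹ `∃ f > 1/4, C`: `|⟨S⁺_x S⁻_y⟩_{β,L}| ≤ C (dist+1)^{-f}` for all `L, x, y`;
* `SpinEtaLineSharp` / `spinEtaLineSharp_holds` — thermodynamic-limit form: for every `ε > 0`
  and `|z| ≥ R(ε)`, `limsup_{L→∞} |⟨S⁺_0 S⁻_z⟩_{β,L+1}| ≤ |z|^{-(1-ε)/(πβ|t|)}`; i.e. the
  magnetic McBryan–Spencer exponent `η_spin(T) ≥ T/(π|t|)` for the Hubbard model at every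
  `U`, `μ` — improving the tree's `1/(128β|t|+1)` by the factor `128/π ≈ 41` at large `β|t|`.

Reading (bounds.tex Cor 10.2): for `T > (π/4)|t| ≈ 0.785|t|` the transverse spin correlations
of the 2D Hubbard model decay faster than the Nelson–Kosterlitz/BKT borderline `r^{-1/4}`,
whatever `U` and the filling — an in-plane (XY-type) magnetic quasi-long-range order with
`η ≤ 1/4` can only occur at `T ≤ (π/4)|t|`; unconditional, machine-checked. NOT claimed:
optimality of `1/(πβ|t|)` within the method, anything at `T < (π/4)|t|`, and any statement on
`S^z` correlations (gauge-neutral; the method gives nothing).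

References (keys of `lean/references.bib`): KomaTasakiPRL1992 (Theorem, eqs. (5)–(13), last
paragraph of the proof); McBryanSpencer1977; NelsonKosterlitz1977; FriedliVelenikSMLS2017 §3.1.
-/

noncomputable section

namespace Summit.HubbardSuperconductivity.HubbardLadder.Bounds

open Matrix Finset NormedSpace
open Literature.MathematicalPhysics.QuantumLattice Literature.Probability.LatticeModels
open scoped Matrix.Norms.L2Operator ComplexOrder

/-! ### Generic step 1: a priori gauge bound ⟹ sharp power law on the torus -/

/-- **Euclidean-dipole form of a Koma–Tasaki a priori bound, parametric in the gauge charge `c`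
and the cost constant `b`.** If a quantity `g` obeys, for every real site function `φ` on
`(ℤ/Lℤ)²`, `g ≤ e^{-c(φ_x - φ_y)} exp[b Σ_u Σ_v [u∼v](cosh(φ_u - φ_v) - 1)]` with `b ≥ 0`, then
for every `q ≥ 0` with `f = 2cq - 4πbq² ≥ 0`: `g ≤ K 5^f (dist(x,y)+1)^{-f}`,
`K = exp[2b(2πq² + 76q² + 544q⁴e^{2q²})]` (Euclidean dipole of radius `ρ = ⌊(dist-1)/2⌋ ≥
(dist+1)/5`, `H(ρ) ≤ 1 + log ρ`; `φ = 0` at distance `≤ 2`). -/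
theorem le_rpow_euclid_of_apriori (L : ℕ) [NeZero L] (b c q g f : ℝ) (hb : 0 ≤ b)
    (hq : 0 ≤ q) (x y : TorusSite 2 L)
    (hAP : ∀ φ : TorusSite 2 L → ℝ,
      g ≤ Real.exp (-(c * (φ x - φ y))) * Real.exp (b *
          ∑ u : TorusSite 2 L, ∑ v : TorusSite 2 L,
            (if (torusGraph 2 L).Adj u v then (Real.cosh (φ u - φ v) - 1) else 0)))
    (hfq : f = 2 * c * q - 4 * Real.pi * b * q ^ 2) (hf : 0 ≤ f) :
    g ≤ Real.exp (2 * b * (2 * Real.pi * q ^ 2 + 76 * q ^ 2 + 544 * q ^ 4 * Real.exp (2 * q ^ 2))) *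
        ((5 : ℝ) ^ f * ((torusDist x y : ℝ) + 1) ^ (-f)) := by
  set K : ℝ := Real.exp (2 * b *
    (2 * Real.pi * q ^ 2 + 76 * q ^ 2 + 544 * q ^ 4 * Real.exp (2 * q ^ 2))) with hK
  have hK1 : 1 ≤ K := Real.one_le_exp (by positivity)
  set R : ℕ := torusDist x y with hR
  have hR1 : (0 : ℝ) < (R : ℝ) + 1 := by positivity
  by_cases hR3 : R < 3
  · -- short distances: the bound with `φ = 0` is `g ≤ 1 ≤ K 5^f (R+1)^{-f}` (`R + 1 ≤ 5`)
    have h0 := hAP (fun _ => 0)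
    simp only [sub_self, mul_zero, neg_zero, Real.cosh_zero, ite_self, sum_const_zero,
      Real.exp_zero, mul_one] at h0
    have hge1 : 1 ≤ (5 : ℝ) ^ f * ((R : ℝ) + 1) ^ (-f) := by
      rw [Real.rpow_neg hR1.le, ← div_eq_mul_inv, ← Real.div_rpow (by norm_num) hR1.le]
      refine Real.one_le_rpow ?_ hf
      rw [le_div_iff₀ hR1]
      have : (R : ℝ) ≤ 2 := by exact_mod_cast (by omega : R ≤ 2)
      linarith
    calc g ≤ 1 := h0
      _ ≤ K * ((5 : ℝ) ^ f * ((R : ℝ) + 1) ^ (-f)) := by nlinarith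
  · -- the Euclidean dipole of radius `ρ = ⌊(R-1)/2⌋ ≥ 1`
    have hR3' : 3 ≤ R := not_lt.1 hR3
    set ρ : ℕ := (R - 1) / 2 with hρdef
    have hρ1 : 1 ≤ ρ := by omega
    have hρR : 2 * ρ + 1 ≤ torusDist x y := by rw [← hR]; omega
    have h5ρ : R + 1 ≤ 5 * ρ := by omega
    obtain ⟨φ, hgain, hE⟩ := exists_euclidLogDipole L x y q hq ρ hρ1 hρR
    have key := hAP φ
    rw [hgain] at key
    have hρ0 : (0 : ℝ) < (ρ : ℝ) := by exact_mod_cast hρ1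
    have hH : (harmonic ρ : ℝ) ≤ 1 + Real.log ρ := harmonic_le_one_add_log ρ
    have hfifth : ((R : ℝ) + 1) / 5 ≤ (ρ : ℝ) := by
      have h' : ((R : ℝ) + 1) ≤ 5 * (ρ : ℝ) := by exact_mod_cast h5ρ
      linarith
    have hfifth0 : (0 : ℝ) < ((R : ℝ) + 1) / 5 := by positivity
    calc g ≤ Real.exp (-(c * (2 * q * Real.log ρ))) * Real.exp (b *
            ∑ u : TorusSite 2 L, ∑ v : TorusSite 2 L,
              (if (torusGraph 2 L).Adj u v then (Real.cosh (φ u - φ v) - 1) else 0)) := key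
      _ ≤ Real.exp (-(c * (2 * q * Real.log ρ))) * Real.exp (b *
            (2 * (2 * Real.pi * q ^ 2 * (harmonic ρ : ℝ) + 76 * q ^ 2 +
              544 * q ^ 4 * Real.exp (2 * q ^ 2)))) := by
          gcongr
      _ ≤ Real.exp (-(c * (2 * q * Real.log ρ))) * Real.exp (b *
            (2 * (2 * Real.pi * q ^ 2 * (1 + Real.log ρ) + 76 * q ^ 2 +
              544 * q ^ 4 * Real.exp (2 * q ^ 2)))) := by
          gcongr
      _ = K * Real.exp (-(f * Real.log ρ)) := by
          rw [hK, ← Real.exp_add, ← Real.exp_add, hfq]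
          congr 1
          ring
      _ = K * (ρ : ℝ) ^ (-f) := by
          rw [Real.rpow_def_of_pos hρ0]
          congr 2
          ring
      _ ≤ K * (((R : ℝ) + 1) / 5) ^ (-f) := by
          gcongr K * ?_
          exact Real.rpow_le_rpow_of_nonpos hfifth0 hfifth (by linarith)
      _ = K * ((5 : ℝ) ^ f * ((R : ℝ) + 1) ^ (-f)) := by
          rw [Real.div_rpow hR1.le (by norm_num), Real.rpow_neg (by norm_num : (0:ℝ) ≤ 5),
            div_inv_eq_mul, mul_comm (((R : ℝ) + 1) ^ (-f))]

/-! ### Generic step 2: torus bound ⟹ thermodynamic-limit power law -/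

/-- **From a torus-uniform power law to the `limsup_{L→∞}` power law.** If nonnegative numbers
`G_L(z)` (`L ≥ 0`, `z ∈ ℤ²`) satisfy `G_L(z) ≤ K 5^f (dist_{L+1}(0,z) + 1)^{-f}` with the torus
distance on `(ℤ/(L+1)ℤ)²`, `K, f, e > 0`, then for `|z| ≥ R := max((K(5√2)^f)^{1/e}, 1)`:
`limsup_{L→∞} G_L(z) ≤ |z|^{-f+e}` (for `L + 1 > 2 max|z_i|` the torus distance is
`max|z_i| ≥ |z|/√2`). -/
theorem exists_limsup_le_rpow (G : ℕ → (Fin 2 → ℤ) → ℝ) (K f e : ℝ) (hK : 0 < K) (hf : 0 < f)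
    (he : 0 < e) (hG0 : ∀ L z, 0 ≤ G L z)
    (hGb : ∀ (L : ℕ) (z : Fin 2 → ℤ), G L z ≤ K * ((5 : ℝ) ^ f *
      ((torusDist (torusSiteOfInt (L + 1) 0) (torusSiteOfInt (L + 1) z) : ℝ) + 1) ^ (-f))) :
    ∃ R : ℝ, ∀ z : Fin 2 → ℤ, R ≤ intNorm z →
      Filter.limsup (fun L : ℕ => G L z) Filter.atTop ≤ intNorm z ^ (-f + e) := by
  have hcob : ∀ z, Filter.IsCoboundedUnder (· ≤ ·) Filter.atTop (fun L : ℕ => G L z) :=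
    fun z => Filter.isCoboundedUnder_le_of_le _ (fun L => hG0 L z)
  set K₂ : ℝ := K * (5 : ℝ) ^ f * Real.sqrt 2 ^ f with hK2
  have hK2pos : 0 < K₂ := by positivity
  set R₀ : ℝ := K₂ ^ (1 / e) with hR0
  refine ⟨max R₀ 1, fun z hz => ?_⟩
  have hN1 : 1 ≤ intNorm z := le_trans (le_max_right _ _) hz
  have hNR : R₀ ≤ intNorm z := le_trans (le_max_left _ _) hz
  have hN0 : 0 < intNorm z := by linarith
  -- `m = max |z_i| ≥ 1` and `|z| ≤ √2 m`
  set m : ℕ := max (z 0).natAbs (z 1).natAbs with hm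
  have hNm : intNorm z ≤ Real.sqrt 2 * m := intNorm_le_sqrt_two_mul z
  have hm1 : 1 ≤ m := by
    by_contra hm0
    have hm0' : m = 0 := by omega
    have h0 : z 0 = 0 := Int.natAbs_eq_zero.1 (by omega)
    have h1 : z 1 = 0 := Int.natAbs_eq_zero.1 (by omega)
    have : intNorm z = 0 := by
      simp [intNorm, h0, h1]
    linarith
  have hm0 : (0 : ℝ) < m := by exact_mod_cast hm1
  have hsqrt2 : 0 < Real.sqrt 2 := by positivity
  have hNdiv : intNorm z / Real.sqrt 2 ≤ (m : ℝ) + 1 := by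
    rw [div_le_iff₀ hsqrt2]
    nlinarith
  have hNdiv0 : 0 < intNorm z / Real.sqrt 2 := by positivity
  -- termwise bound for `L + 1 > 2m`
  have hev : ∀ᶠ L : ℕ in Filter.atTop, G L z ≤ K₂ * intNorm z ^ (-f) := by
    refine Filter.eventually_atTop.2 ⟨2 * m, fun L hL => ?_⟩
    have hdist : torusDist (torusSiteOfInt (L + 1) 0) (torusSiteOfInt (L + 1) z) = m :=
      torusDist_torusSiteOfInt_zero (L + 1) z (by omega)
    have hbound := hGb L z
    rw [hdist] at hbound
    calc G L z ≤ K * ((5 : ℝ) ^ f * ((m : ℝ) + 1) ^ (-f)) := hbound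
      _ ≤ K * ((5 : ℝ) ^ f * (intNorm z / Real.sqrt 2) ^ (-f)) := by
          gcongr K * ((5 : ℝ) ^ f * ?_)
          exact Real.rpow_le_rpow_of_nonpos hNdiv0 hNdiv (by linarith)
      _ = K₂ * intNorm z ^ (-f) := by
          rw [Real.div_rpow hN0.le hsqrt2.le, Real.rpow_neg hsqrt2.le, div_inv_eq_mul, hK2]
          ring
  -- absorb the constant into the slack `e`
  have hK2le : K₂ ≤ intNorm z ^ e := by
    have h1 : R₀ ^ e ≤ intNorm z ^ e := Real.rpow_le_rpow (by positivity) hNR he.le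
    have h2 : R₀ ^ e = K₂ := by
      rw [hR0, ← Real.rpow_mul hK2pos.le, one_div_mul_cancel he.ne', Real.rpow_one]
    rw [h2] at h1
    exact h1
  have hfinal : K₂ * intNorm z ^ (-f) ≤ intNorm z ^ (-f + e) := by
    rw [Real.rpow_add hN0]
    have hpow0 : 0 ≤ intNorm z ^ (-f) := Real.rpow_nonneg hN0.le _
    calc K₂ * intNorm z ^ (-f) ≤ intNorm z ^ e * intNorm z ^ (-f) := by gcongr
      _ = intNorm z ^ (-f) * intNorm z ^ e := mul_comm _ _
  exact (Filter.limsup_le_of_le (hcob z) hev).trans hfinal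

/-! ### The sharp magnetic bound on the torus -/

/-- **The sharp explicit magnetic bound (Koma–Tasaki's printed hopping norm, spin gauge;
machine-checked).** For the nearest-neighbour Hubbard model on `(ℤ/Lℤ)²`, all real `t, U, μ`,
every `β ≥ 0`, every `q ≥ 0` with `f := 4q - 4πβ|t|q² ≥ 0`, and all sites `x, y`:
`|⟨S⁺_x S⁻_y⟩_{β,L}| ≤ K(q) 5^f (dist(x,y)+1)^{-f}`, `K(q) = exp[2β|t|(2πq² + 76q² + 544q⁴e^{2q²})]`,
uniformly in `L`; at `q = 1/(2πβ|t|)` the exponent is `1/(πβ|t|) = T/(π|t|)`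
(bounds.tex Thm 10‴). -/
theorem norm_spinCorr_le_rpow_euclid (L : ℕ) [NeZero L] (t U μ β q : ℝ) (hβ : 0 ≤ β)
    (hq : 0 ≤ q) (hf : 0 ≤ 4 * q - 4 * Real.pi * (β * |t|) * q ^ 2) (x y : TorusSite 2 L) :
    ‖(hubbardTorusWith 2 L t U μ).thermalCorr β (siteSpinPlus x) (siteSpinPlus y)ᴴ‖ ≤
      Real.exp (2 * (β * |t|) *
          (2 * Real.pi * q ^ 2 + 76 * q ^ 2 + 544 * q ^ 4 * Real.exp (2 * q ^ 2))) *
        ((5 : ℝ) ^ (4 * q - 4 * Real.pi * (β * |t|) * q ^ 2) *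
          ((torusDist x y : ℝ) + 1) ^ (-(4 * q - 4 * Real.pi * (β * |t|) * q ^ 2))) :=
  le_rpow_euclid_of_apriori L (β * |t|) 2 q _ _ (mul_nonneg hβ (abs_nonneg t)) hq x y
    (fun φ => (norm_thermalCorr_siteSpinPlus_le_sharp t U μ β hβ φ x y).trans_eq
      (by rw [mul_assoc]))
    (by ring) hf

/-- For every `M ≥ 1` and `z`, the transverse spin correlation between `0` and `z` on `(ℤ/Mℤ)²`
is at most `1` (the a priori bound with `ψ = 0`). -/
theorem norm_spinCorr_torusSiteOfInt_le_one (M : ℕ) [NeZero M] (t U μ β : ℝ) (hβ : 0 ≤ β)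
    (z : Fin 2 → ℤ) :
    ‖(hubbardTorusWith 2 M t U μ).thermalCorr β
        (siteSpinPlus (torusSiteOfInt M 0)) (siteSpinPlus (torusSiteOfInt M z))ᴴ‖ ≤ 1 := by
  have h0 := norm_thermalCorr_siteSpinPlus_le_sharp t U μ β hβ (fun _ => (0 : ℝ))
    (torusSiteOfInt M 0) (torusSiteOfInt M z)
  simp only [sub_self, mul_zero, neg_zero, Real.cosh_zero, ite_self, sum_const_zero,
    Real.exp_zero, mul_one] at h0
  exact h0

/-! ### The sharp magnetic `η`-line, torus-uniform form -/

/-- **Cor 10.2 (torus form, sharp constant; PROVED below).** Nearest-neighbour Hubbard model on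
`(ℤ/Lℤ)²`, any real `t, U, μ`, `β > 0` with `β|t| < 4/π` (temperature `T > (π/4)|t| ≈ 0.785|t|`,
the McBryan–Spencer/Koma–Tasaki `η = 1/4` line with the printed hopping norm): there are
`f > 1/4` and `C` with `|⟨S⁺_x S⁻_y⟩_{β,L}| ≤ C (dist(x,y)+1)^{-f}` for all `L, x, y` — no in-plane
magnetic quasi-long-range order with `η ≤ 1/4` there, whatever `U`, `μ`. kind: support (PROVED).
Why it might fail: it cannot (proved); NOT claimed: optimality of the exponent within the
method, and anything about `S^z` correlations. Sources: KomaTasakiPRL1992 Theorem, eqs. (5)–(13),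
last paragraph of the proof; McBryanSpencer1977; NelsonKosterlitz1977; this cell bounds.tex
Thm 10‴. -/
@[conjecture] def SpinEtaLineEuclid : Prop :=
  ∀ (t U μ β : ℝ), 0 < β → β * |t| < 4 / Real.pi →
    ∃ f C : ℝ, 1 / 4 < f ∧ ∀ (L : ℕ) [NeZero L] (x y : TorusSite 2 L),
      ‖(hubbardTorusWith 2 L t U μ).thermalCorr β (siteSpinPlus x) (siteSpinPlus y)ᴴ‖ ≤
        C * ((torusDist x y : ℝ) + 1) ^ (-f)

/-- **`SpinEtaLineEuclid` holds** (witness `q = 1/4` when `πβ|t| ≤ 2`, `f = 1 - πβ|t|/4 ≥ 1/2`;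
else `q = 1/(2πβ|t|)`, `f = 1/(πβ|t|) > 1/4`; `C = K(q) 5^f`). -/
theorem spinEtaLineEuclid_holds : SpinEtaLineEuclid := by
  intro t U μ β hβ hb
  have hβt : 0 ≤ β * |t| := mul_nonneg hβ.le (abs_nonneg t)
  have hπ := Real.pi_pos
  have hb4 : Real.pi * (β * |t|) < 4 := by
    have := (lt_div_iff₀ hπ).1 hb
    linarith
  by_cases hc : Real.pi * (β * |t|) ≤ 2
  · -- `q = 1/4`
    have hf0 : 0 ≤ 4 * (1 / 4 : ℝ) - 4 * Real.pi * (β * |t|) * (1 / 4 : ℝ) ^ 2 := by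
      nlinarith
    refine ⟨4 * (1 / 4 : ℝ) - 4 * Real.pi * (β * |t|) * (1 / 4 : ℝ) ^ 2,
      Real.exp (2 * (β * |t|) * (2 * Real.pi * (1 / 4 : ℝ) ^ 2 + 76 * (1 / 4 : ℝ) ^ 2 +
        544 * (1 / 4 : ℝ) ^ 4 * Real.exp (2 * (1 / 4 : ℝ) ^ 2))) *
        (5 : ℝ) ^ (4 * (1 / 4 : ℝ) - 4 * Real.pi * (β * |t|) * (1 / 4 : ℝ) ^ 2),
      by nlinarith, fun L _ x y => ?_⟩
    rw [mul_assoc]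
    exact norm_spinCorr_le_rpow_euclid L t U μ β (1 / 4) hβ.le (by norm_num) hf0 x y
  · -- `q = q* = 1/(2πβ|t|)`
    have hc' : 2 < Real.pi * (β * |t|) := not_le.1 hc
    have hb0 : 0 < β * |t| := by
      rcases hβt.eq_or_lt with h | h
      · rw [← h, mul_zero] at hc'; linarith
      · exact h
    set q : ℝ := 1 / (2 * Real.pi * (β * |t|)) with hq
    have hq0 : 0 ≤ q := by positivity
    have hfval : 4 * q - 4 * Real.pi * (β * |t|) * q ^ 2 = 1 / (Real.pi * (β * |t|)) := by
      rw [hq]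
      field_simp
      ring
    have hf4 : 1 / 4 < 4 * q - 4 * Real.pi * (β * |t|) * q ^ 2 := by
      rw [hfval, div_lt_div_iff₀ (by norm_num) (by positivity)]
      linarith
    refine ⟨4 * q - 4 * Real.pi * (β * |t|) * q ^ 2,
      Real.exp (2 * (β * |t|) * (2 * Real.pi * q ^ 2 + 76 * q ^ 2 +
        544 * q ^ 4 * Real.exp (2 * q ^ 2))) *
        (5 : ℝ) ^ (4 * q - 4 * Real.pi * (β * |t|) * q ^ 2), hf4, fun L _ x y => ?_⟩
    rw [mul_assoc]
    exact norm_spinCorr_le_rpow_euclid L t U μ β q hβ.le hq0 (by linarith) x y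

/-! ### The sharp magnetic exponent `η_spin(T) ≥ T/(π|t|)`, thermodynamic-limit form -/

/-- **Thm 10‴ (the sharp Koma–Tasaki magnetic decay exponent; PROVED below).** For all real
`t, U, μ`, every `β > 0` and `ε > 0` there is `R` such that for every `z ∈ ℤ²` with `|z| ≥ R`,
`limsup_{L→∞} |⟨S⁺_0 S⁻_z⟩_{β,L+1}| ≤ |z|^{-(1-ε)/(πβ|t|)}` — the transverse spin correlations of
the 2D Hubbard model decay at least as fast as `|z|^{-η}` with `η = T/(π|t|)` (McBryan–Spencer's
exponent for the plane rotator, with Koma–Tasaki's printed hopping norm; the tree's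
`koma_tasaki_magnetic` has `1/(128β|t|+1)`). At `t = 0` the exponent is the junk value `0` and
the bound `1` holds. kind: support (PROVED). Why it might fail: it cannot (proved); the
`limsup` form sidesteps the (unformalised) infinite-volume Gibbs state exactly as
`PairEtaLineSharp` does. Sources: KomaTasakiPRL1992 Theorem and last paragraph of the proof;
McBryanSpencer1977; this cell bounds.tex Thm 10‴. -/
@[conjecture] def SpinEtaLineSharp : Prop :=
  ∀ (t U μ β : ℝ), 0 < β → ∀ ε : ℝ, 0 < ε → ∃ R : ℝ, ∀ z : Fin 2 → ℤ, R ≤ intNorm z →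
    Filter.limsup (fun L : ℕ => ‖(hubbardTorusWith 2 (L + 1) t U μ).thermalCorr β
        (siteSpinPlus (torusSiteOfInt (L + 1) 0)) (siteSpinPlus (torusSiteOfInt (L + 1) z))ᴴ‖)
      Filter.atTop ≤ intNorm z ^ (-((1 - ε) / (Real.pi * β * |t|)))

/-- **`SpinEtaLineSharp` holds**: `norm_spinCorr_le_rpow_euclid` at `q* = 1/(2πβ|t|)`
(`f* = 1/(πβ|t|)`) fed into `exists_limsup_le_rpow` with slack `e = ε f*`; at `t = 0` termwise
`≤ 1`. -/
theorem spinEtaLineSharp_holds : SpinEtaLineSharp := by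
  intro t U μ β hβ ε hε
  by_cases ht : β * |t| = 0
  · -- `t = 0`: the exponent is the junk value `0`, the bound `1` holds termwise
    refine ⟨0, fun z _ => ?_⟩
    have hexp : -((1 - ε) / (Real.pi * β * |t|)) = 0 := by
      rw [mul_assoc, ht, mul_zero, div_zero, neg_zero]
    rw [hexp, Real.rpow_zero]
    exact Filter.limsup_le_of_le
      (Filter.isCoboundedUnder_le_of_le _ (fun L => norm_nonneg _))
      (Filter.Eventually.of_forall fun L =>
        norm_spinCorr_torusSiteOfInt_le_one (L + 1) t U μ β hβ.le z)
  · -- `β|t| > 0`: the Euclidean dipole at `q* = 1/(2πβ|t|)`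
    have hβt : 0 ≤ β * |t| := mul_nonneg hβ.le (abs_nonneg t)
    have hb0 : 0 < β * |t| := lt_of_le_of_ne hβt (Ne.symm ht)
    have hπ := Real.pi_pos
    set q : ℝ := 1 / (2 * Real.pi * (β * |t|)) with hq
    have hq0 : 0 ≤ q := by positivity
    set fs : ℝ := 4 * q - 4 * Real.pi * (β * |t|) * q ^ 2 with hfs
    have hfval : fs = 1 / (Real.pi * (β * |t|)) := by
      rw [hfs, hq]
      field_simp
      ring
    have hfpos : 0 < fs := by rw [hfval]; positivity
    have hεf : 0 < ε * fs := by positivity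
    obtain ⟨R, hR⟩ := exists_limsup_le_rpow
      (fun L z => ‖(hubbardTorusWith 2 (L + 1) t U μ).thermalCorr β
        (siteSpinPlus (torusSiteOfInt (L + 1) 0)) (siteSpinPlus (torusSiteOfInt (L + 1) z))ᴴ‖)
      (Real.exp (2 * (β * |t|) *
        (2 * Real.pi * q ^ 2 + 76 * q ^ 2 + 544 * q ^ 4 * Real.exp (2 * q ^ 2))))
      fs (ε * fs) (Real.exp_pos _) hfpos hεf (fun L z => norm_nonneg _)
      (fun L z => norm_spinCorr_le_rpow_euclid (L + 1) t U μ β q hβ.le hq0 hfpos.le _ _)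
    refine ⟨R, fun z hz => ?_⟩
    have hexp : -((1 - ε) / (Real.pi * β * |t|)) = -fs + ε * fs := by
      rw [hfval]
      field_simp
      ring
    rw [hexp]
    exact hR z hz

end Summit.HubbardSuperconductivity.HubbardLadder.Bounds

end
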